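import Summits.CriticalPhenomena.SAWScalingLimit.Theorems.SAWLeftRightFKGLeftRightFKGRectBoundaryWalk
import Summits.CriticalPhenomena.SAWScalingLimit.Theorems.SAWLeftRightFKGLeftRightFKGFKGTransfer
import Summits.CriticalPhenomena.SAWScalingLimit.Theorems.SAWLeftRightFKGLeftRightFKGLadderStructure
import Summits.CriticalPhenomena.SAWScalingLimit.Theorems.SAWLeftRightFKGLeftRightFKGLadderChords
import Summits.CriticalPhenomena.SAWScalingLimit.Theorems.LeftRightFKG.Negative.RectMesh
import HarnessLib

/-!
# The ladder family of crux `LeftRightFKG` (stmt-CriticalPhenomena-11232), line `corner-localisation`, lead c4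

LEFT–RIGHT POSITIVE ASSOCIATION ON EVERY 2-ROW LADDER, AT EVERY FUGACITY — the first PROVED infinite family of
instances of the crux `Summit.CriticalPhenomena.SAWScalingLimit.Theses.SAWLeftRightFKG.LeftRightFKG`.

For every `L : ℕ` the counter-clockwise boundary walk `C` of the lattice rectangle `[-1, L+1] × [-1, 2]`
(`Families.stub_rectBoundaryWalk`) realises the ladder `{0..L} × {0,1}` as a crux domain: `meshDomain (dom C 1) 1` is the
open box and adjacency in `(dom C 1)_1` is lattice adjacency inside it (`Negative.Rect.meshDomain_Ω`, `Negative.Rect.dAdj_iff`),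
with `(0,-1), (L,-1)` on the boundary walk, so that `(δ, C, a, b, a', b') = (1, C, (0,0), (L,0), (0,-1), (L,-1))` satisfies the
crux's instance hypotheses (`CornerLoc.IsInst`). The chords `(0,0) → (L,0)` are in bijection with `Fin L → Bool` by their
facewise crossing indicators, pointwise order implies the left–right order `≼`, and chord length is submodular along the
bijection (`Families.stub_ladderStructure`, `Families.stub_ladderChords_of_structure`); hence the fugacity-`x` chord measure
`μx x` is log-supermodular on a finite distributive lattice for `0 ≤ x ≤ 1` and the FKG inequality
(`Families.stub_fkgTransfer`, Mathlib's four-functions theorem) gives the crux's event-form inequality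
`μ(A) μ(B) ≤ μ(univ) μ(A ∩ B)` for all `≼`-up-closed `A, B` — at every fugacity `0 ≤ x ≤ 1` (`ladderPA`), in particular for
the critical weight `SAW.weight = μx x_c` (`ladder_leftRightFKG`).

Why this family and no more by this mechanism: in a 2-row ladder every site has degree `≤ 3` and the chord poset IS the
Boolean lattice; from height 3 on, ℤ² chords have "kissing corners", the left–right poset is no longer a lattice, and the
association thresholds of long strips (`0.500, 0.458, 0.437, 0.427, …` for widths `3, 4, 5, 6`, disprover's exact transfer
matrices) descend towards `x_c` — the crux proper. Elementary ("folklore") given the landed stubs.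
-/

noncomputable section

open MeasureTheory
open Literature.Probability.LatticeModels Literature.Probability.RandomPlanarGeometry
open Summit.CriticalPhenomena.SAWScalingLimit.Theorems.LeftRightFKG.Negative (bx pathCross wcross)
open Summit.CriticalPhenomena.SAWScalingLimit.Theorems.LeftRightFKG.CornerLoc (lr IsUp μx dom IsInst weight_eq_μx)
open scoped Classical ENNReal

namespace Summit.CriticalPhenomena.SAWScalingLimit.Theorems.LeftRightFKG.Families

/-- STRUCTURE OF THE 2-ROW LADDER in the form consumed by the FKG transfer (glue of `stub_ladderStructure` and
`stub_ladderChords_of_structure`): for the crossing-indicator map `f γ = (1 ≤ wcross i 0 γ)_{i<L}` on the chords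
`(0,0) → (L,0)` of the ladder — a bijection onto `Fin L → Bool`, pointwise `≤` implies `≼`, length submodular. [folklore] -/
theorem ladderChords : ∀ (L : ℕ) (Ω : Set ℂ),
    (∀ u v : Site 2, (discreteDomainGraph Ω 1).Adj u v ↔
      (zdGraph 2).Adj u v ∧ u ∈ Negative.Rect.box (-1) (L + 1) (-1) 2 ∧ v ∈ Negative.Rect.box (-1) (L + 1) (-1) 2) →
    ∀ f : SAW.DomainSAW Ω 1 (bx 0 0) (bx L 0) → (Fin L → Bool),
    (∀ (γ : SAW.DomainSAW Ω 1 (bx 0 0) (bx L 0)) (i : Fin L), f γ i = decide (1 ≤ wcross (i : ℤ) 0 γ.walk)) →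
    Function.Bijective f ∧
    (∀ γ₁ γ₂, f γ₁ ≤ f γ₂ → lr γ₁ γ₂) ∧
    (∀ γ₁ γ₂ γ₃ γ₄, f γ₃ = f γ₁ ⊓ f γ₂ → f γ₄ = f γ₁ ⊔ f γ₂ → γ₃.length + γ₄.length ≤ γ₁.length + γ₂.length) :=
  stub_ladderChords_of_structure stub_ladderStructure

/-- **THE LADDER FAMILY, every fugacity.** For every `L`, the boundary walk of `[-1, L+1] × [-1, 2]` realises the ladder
`{0..L} × {0,1}` as a crux domain `dom C 1` (with `(0,-1)` and `(L,-1)` on the walk), and the fugacity-`x` chord measure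
between the bottom corners `(0,0)`, `(L,0)` is positively associated in the crux's event form for all `≼`-up-closed events,
for EVERY `0 ≤ x ≤ 1`. [folklore] -/
theorem ladderPA : ∀ L : ℕ, ∃ C : (zdGraph 2).Walk (bx (-1) (-1)) (bx (-1) (-1)),
    bx 0 (-1) ∈ C.support ∧ bx L (-1) ∈ C.support ∧
    meshDomain (dom C 1) 1 = Negative.Rect.box (-1) (L + 1) (-1) 2 ∧
    ∀ x : ℝ, 0 ≤ x → x ≤ 1 → ∀ A B : Set (SAW.DomainSAW (dom C 1) 1 (bx 0 0) (bx L 0)), IsUp A → IsUp B →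
      μx x (dom C 1) 1 (bx 0 0) (bx L 0) A * μx x (dom C 1) 1 (bx 0 0) (bx L 0) B ≤
        μx x (dom C 1) 1 (bx 0 0) (bx L 0) Set.univ * μx x (dom C 1) 1 (bx 0 0) (bx L 0) (A ∩ B) := by
  intro L
  obtain ⟨C, hb, hch, hcomp, hcross⟩ :=
    stub_rectBoundaryWalk (-1) (L + 1) (-1) 2 (by omega) (by omega)
  have hface : (-1 : ℤ) ≤ -1 ∧ (-1 : ℤ) + 1 ≤ L + 1 ∧ (-1 : ℤ) ≤ -1 ∧ (-1 : ℤ) + 1 ≤ 2 := by omega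
  have hcross' : pathCross (-1) (-1) (bx (-1) (-1)) C.support.tail ≠ 0 := by rw [hcross]; decide
  have hdom : dom C 1 = Negative.Rect.Ω C := rfl
  refine ⟨C, hcomp 0 (-1) (by omega) (by omega) le_rfl (by omega) (Or.inr (Or.inr (Or.inl rfl))),
    hcomp L (-1) (by omega) (by omega) le_rfl (by omega) (Or.inr (Or.inr (Or.inl rfl))), ?_, ?_⟩
  · rw [hdom]; exact Negative.Rect.meshDomain_Ω hb hch hcomp hface hcross'
  · intro x hx0 hx1 A B hA hB
    have hadj : ∀ u v : Site 2, (discreteDomainGraph (dom C 1) 1).Adj u v ↔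
        (zdGraph 2).Adj u v ∧ u ∈ Negative.Rect.box (-1) (L + 1) (-1) 2 ∧
          v ∈ Negative.Rect.box (-1) (L + 1) (-1) 2 := fun u v => by
      rw [hdom]; exact Negative.Rect.dAdj_iff hb hch hcomp hface hcross'
    obtain ⟨hbij, hmono, hsub⟩ := ladderChords L (dom C 1) hadj
      (fun γ i => decide (1 ≤ wcross (i : ℤ) 0 γ.walk)) (fun _ _ => rfl)
    haveI : Fintype (SAW.DomainSAW (dom C 1) 1 (bx 0 0) (bx L 0)) := Fintype.ofInjective _ hbij.1
    exact stub_fkgTransfer (dom C 1) 1 (bx 0 0) (bx L 0) (Fin L → Bool) _ hbij hmono hsub x hx0 hx1 A B hA hB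

/-- **THE LADDER FAMILY IN THE CRUX'S OWN SHAPE.** For every `L` there is an honest crux instance
`(δ, C, a, b, a', b') = (1, ∂[-1,L+1]×[-1,2], (0,0), (L,0), (0,-1), (L,-1))` (`IsInst`: positive mesh, `a', b'` on the
boundary walk, `a ∼ a'`, `b ∼ b'`) whose discrete domain is the ladder `{0..L} × {0,1}` and whose CRITICAL chord measure
`SAW.weight = μx x_c` satisfies the crux's inequality `w(A)·w(B) ≤ w(univ)·w(A ∩ B)` for all `≼`-up-closed `A, B` —
the conclusion of `LeftRightFKG` on this infinite family of its instances. [folklore] -/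
theorem ladder_leftRightFKG : ∀ L : ℕ, ∃ C : (zdGraph 2).Walk (bx (-1) (-1)) (bx (-1) (-1)),
    IsInst 1 (bx 0 0) (bx L 0) (bx 0 (-1)) (bx L (-1)) C ∧
    meshDomain (dom C 1) 1 = Negative.Rect.box (-1) (L + 1) (-1) 2 ∧
    ∀ A B : Set (SAW.DomainSAW (dom C 1) 1 (bx 0 0) (bx L 0)), IsUp A → IsUp B →
      SAW.weight (dom C 1) 1 (bx 0 0) (bx L 0) A * SAW.weight (dom C 1) 1 (bx 0 0) (bx L 0) B ≤
        SAW.weight (dom C 1) 1 (bx 0 0) (bx L 0) Set.univ * SAW.weight (dom C 1) 1 (bx 0 0) (bx L 0) (A ∩ B) := by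
  intro L
  obtain ⟨C, ha', hb', hdom, hPA⟩ := ladderPA L
  refine ⟨C, ⟨one_pos, ha', hb', ?_, ?_⟩, hdom, fun A B hA hB => ?_⟩
  · exact Negative.adj_bx 0 0 0 (-1) (by omega)
  · exact Negative.adj_bx L 0 L (-1) (by omega)
  · simpa only [weight_eq_μx] using
      hPA SAW.criticalFugacity SAW.criticalFugacity_pos_lt_one'.1.le SAW.criticalFugacity_pos_lt_one'.2.le A B hA hB

end Summit.CriticalPhenomena.SAWScalingLimit.Theorems.LeftRightFKG.Families

end
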